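import Mathlib
import Summits.Ventures.FusionMHD.Models.TearingFRS1
import Literature.Analysis.ODE.RationalTaylorMajorant
import Literature.Analysis.ODE.RegularSingularLogBranchScalar
import Literature.MathematicalPhysics.MHD.TearingOuterRegion
import HarnessLib

/-!
# F3.r3 instance «TearingFRS1.M3»: the (3,2) mode of the peaked-profile family — the scaled marginal tearing
# equation with `m² = 9` and its resonant normal form, local data PROVED admissible

LADDER-GRIDFUSION rung F3.r3, STABILITY-SIDE sibling of the certified instability-side instance `TearingFRS1`
(models/F3-SCOPING.md §7/§7d, model-6; lead SIZED-ASK 2026-08-27T04:55:56Z (d) «new profile 1.5–2 seat-days»).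
MODEL M₃ (MODELLED column): straight cylinder, zero β, uniform `B_z`, single helicity; safety-factor profile
`q(r) = q₀(1 + λ r²/r_a²)` with `λ = 1` and `q₀ = 21/20` — the SAME analytic family as Ham–Connor–Cowley–Hastie–
Hender–Liu, arXiv:1308.2070 §4 (`ν = 1` peaked current `j ∝ (1 + r²/r₀²)⁻²` of Furth–Rutherford–Selberg 1973) but at
`q₀ = 1.05` instead of the printed `1.4` (a DECLARED NEIGHBOUR, not the printed configuration); mode `(m, n) = (3, 2)`,
rational surface `q(r_s) = 3/2`, `r_s² = (m/(n q₀) − 1)/λ · r_a² = (3/7) r_a²` — the same `σ = λ r_s²/r_a² = 3/7` as the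
`(2,1)` surface of `TearingFRS1`, so that in the scaled radius `u = r/r_s` the marginal outer equation [Miyamoto,
*Controlled Fusion and Plasma Physics* (2007) §9.4.1 eq. (9.61), the `γ² → 0` limit; tree predicate
`Literature.MathematicalPhysics.MHD.Tearing.IsCylOuterSolution`] differs from `TearingFRS1.IsScaledOuterSolution` ONLY in
the centrifugal term `m²/u²`:

  `ψ_uu + ψ_u/u − 9ψ/u² − 560 ψ/((7 + 3u²)²(u² − 1)) = 0`   (`IsScaledOuterSolution`),

and at the surface `u = 1 + x` the resonant normal form `x ψ″ + p(x) ψ′ + q(x) ψ = 0` has the SAME `p = x/(1+x)`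
(`TearingFRS1.pc`), the same denominator `Q` (`TearingFRS1.Q`) and the numerator `P` below (`q(0) = −14/5` again, so the
logarithmic coefficient is `κ = 14/5`). Float preview (seat script `work/preview/scan.py`, VALIDATED class only):
`r_s Δ′_{3,2} ≈ −0.912` (wall at `6 r_s`), `−0.935` (wall at `2 r_s`) — the classically STABLE side, i.e. a positive
tearing margin in the sense of `Models/ResistiveSchemas.lean`.

THIS FILE (step (1) of the pipeline, pattern of `TearingFRS1.lean`): `P`, its degree and the numerator sum `≤ 5` at
`ρ = 1/8`; `qc = ratTaylorCoeff P Q` with `|qc n| ≤ 12·8ⁿ` and the sum on `|x| < 1/8`; **`isScalarLogData :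
IsScalarLogData pc qc p q 8 12 (1/8)`**; the closed form `q_eq`; the model predicate `IsScaledOuterSolution` and
`local_normal_form`. Everything shared with the `(2,1)` instance (`pc`, `p`, `Q`, `P₁`, `Q₁` and their lemmas) is
IMPORTED from `TearingFRS1.lean`, not restated (this namespace is nested in `TearingFRS1` for that reason).
MODEL-VALIDITY row: MV-7R (plan/MODEL-VALIDITY.md). [instance data]
-/

noncomputable section

open Finset Filter Metric Polynomial
open scoped Topology

namespace Summit.Ventures.FusionMHD.Models

namespace TearingFRS1

namespace M3

/-! ### The local coefficient data at the rational surface `u = 1` (`x = u − 1`), `m² = 9` -/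

/-- Numerator of `q(x)` for `m = 3`: `P = (−9x(3x²+6x+10)²(x+2) − 560(1+x)²)/200`. [instance data] -/
def P : ℝ[X] :=
  C (-14 / 5) + C (-73 / 5) * X + C (-181 / 10) * X ^ 2 + C (-351 / 25) * X ^ 3 + C (-189 / 25) * X ^ 4
    + C (-243 / 100) * X ^ 5 + C (-81 / 200) * X ^ 6

/-- `deg P ≤ 6`. [instance data] -/
theorem P_natDegree_le : P.natDegree ≤ 6 := by unfold P; compute_degree

/-- numerator sum of `P` at `ρ = 1/8`: `≤ 5` (exact value `4.9371…`). [instance data] -/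
theorem P_sum : ∑ i ∈ range (6 + 1), ‖P.coeff i‖ * (1 / 8 : ℝ) ^ i ≤ 5 := by
  simp only [P, Finset.sum_range_succ, Finset.sum_range_zero, coeff_add, coeff_C_mul, coeff_X_pow,
    coeff_X]
  norm_num

/-! ### Taylor data of `q = P/Q` (division recursion + majorant + convergence) -/

/-- The coefficient sequence of `q = P/Q` for `m = 3` (= `−14/5, −106/25, 3569/250, …`). [instance data] -/
def qc : ℕ → ℝ := Literature.Analysis.ODE.ratTaylorCoeff P Q

/-- `q(x) = P(x)/Q(x)` (= `−9x/(1+x)² − 560/((3x²+6x+10)²(x+2))`, see `q_eq`). [instance data] -/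
def q (x : ℝ) : ℝ := P.eval x / Q.eval x

/-- Taylor data of `q`: `|qc n| ≤ (35/3)·8ⁿ` and `Σ xⁿ qc n = P(x)/Q(x)` on `|x| < 1/8`. [instance data] -/
theorem q_taylor : (∀ n, ‖qc n‖ ≤ 5 / (1 - 4 / 7) * (1 / 8 : ℝ)⁻¹ ^ n) ∧
    ∀ x : ℝ, ‖x‖ < 1 / 8 → Q.eval x ≠ 0 ∧ HasSum (fun n => x ^ n * qc n) (P.eval x / Q.eval x) :=
  Literature.Analysis.ODE.ratTaylor_of_natDegree_le P Q Q_coeff_zero (by norm_num) Q_natDegree_le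
    P_natDegree_le Q_margin (by norm_num) P_sum

/-- `qc 0 = −14/5`: `q₀ = −14/5` as for `m = 2` (the `m²`-term vanishes at the surface), so `κ = 14/5`. [instance data] -/
theorem qc_zero : qc 0 = -14 / 5 := by
  rw [qc, Literature.Analysis.ODE.ratTaylorCoeff_eq]
  simp [P]

/-- **THE LOCAL DATA ARE ADMISSIBLE** (`m = 3`): `IsScalarLogData pc qc p q 8 12 (1/8)`. [instance data] -/
theorem isScalarLogData : Literature.Analysis.ODE.IsScalarLogData pc qc p q 8 12 (1 / 8) where
  a_pos := by norm_num
  K_nonneg := by norm_num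
  ρ₀_pos := by norm_num
  norm_pc_le k _ := by
    have h := p_taylor.1 k
    have h8 : (1 / 8 : ℝ)⁻¹ = 8 := by norm_num
    rw [h8] at h
    refine h.trans (mul_le_mul_of_nonneg_right (by norm_num) (by positivity))
  norm_qc_le k _ := by
    have h := q_taylor.1 k
    have h8 : (1 / 8 : ℝ)⁻¹ = 8 := by norm_num
    rw [h8] at h
    refine h.trans (mul_le_mul_of_nonneg_right (by norm_num) (by positivity))
  pc_zero := pc_zero
  hasSum_p x hx := by
    have h := (p_taylor.2 x hx).2
    have he : P₁.eval x / Q₁.eval x = p x := by simp [P₁, Q₁, p]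
    rwa [he] at h
  hasSum_q x hx := (q_taylor.2 x hx).2

/-! ### Closed forms and the link with the scaled model equation -/

/-- `P(x) = (−9x(3x²+6x+10)²(x+2) − 560(1+x)²)/200`. [instance data] -/
theorem P_eval (x : ℝ) : P.eval x = (-9 * x * (3 * x ^ 2 + 6 * x + 10) ^ 2 * (x + 2) - 560 * (1 + x) ^ 2) / 200 := by
  simp only [P, eval_add, eval_mul, eval_C, eval_X, eval_pow]
  ring

/-- CLOSED FORM of the local coefficient (`m = 3`): `q(x) = −9x/(1+x)² − 560/((3x²+6x+10)²(x+2))` (away from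
`x = −1, −2`). [instance data] -/
theorem q_eq {x : ℝ} (hx1 : 1 + x ≠ 0) (hx2 : x + 2 ≠ 0) :
    q x = -9 * x / (1 + x) ^ 2 - 560 / ((3 * x ^ 2 + 6 * x + 10) ^ 2 * (x + 2)) := by
  have h3 : (3 * x ^ 2 + 6 * x + 10 : ℝ) ≠ 0 := by nlinarith [sq_nonneg (x + 1)]
  have hQ := Q_eval_ne_zero hx1 hx2
  rw [q, div_eq_iff hQ, P_eval, Q_eval]
  set t : ℝ := 3 * x ^ 2 + 6 * x + 10 with ht
  field_simp

/-- **The scaled marginal tearing equation of MODEL M₃** (in `u = r/r_s`): `ψ_uu + ψ_u/u − 9ψ/u² + C(u) ψ = 0` with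
the SAME coupling `C(u) = −560/((7 + 3u²)²(u² − 1))` as `TearingFRS1` (same `σ = 3/7`) and the centrifugal term of
`m = 3`; first-order form `ψ′ = ψ'`, `ψ'′ = −ψ'/u + (9/u² + 560/((7+3u²)²(u²−1))) ψ` on a set avoiding `u ∈ {0, ±1}`.
This is `Literature.MathematicalPhysics.MHD.Tearing.IsCylOuterSolution` [Miyamoto2007 §9.4.1 eq. (9.61), `γ² → 0`]
written out for the profile `q = (21/20)(1 + r²/r_a²)`, mode `(3, 2)`, `r_s² = (3/7) r_a²`, and rescaled.
[model instance predicate — OUR object, not a cited statement] -/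
def IsScaledOuterSolution (ψ ψ' : ℝ → ℝ) (s : Set ℝ) : Prop :=
  ∀ u ∈ s, HasDerivAt ψ (ψ' u) u ∧
    HasDerivAt ψ' (-(ψ' u) / u + (9 / u ^ 2 + 560 / ((7 + 3 * u ^ 2) ^ 2 * (u ^ 2 - 1))) * ψ u) u

/-- THE LOCAL NORMAL FORM (`m = 3`): at `u = 1 + x` (`x ∉ {0, −1, −2}`) the model right-hand side is the unique `D` with
`x D + p(x) ψ' + q(x) ψ = 0`. [instance data] -/
theorem local_normal_form {x ψ₀ ψ₁ D : ℝ} (hx0 : x ≠ 0) (hx1 : 1 + x ≠ 0) (hx2 : x + 2 ≠ 0) :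
    x * D + p x * ψ₁ + q x * ψ₀ = 0 ↔
      D = -ψ₁ / (1 + x) + (9 / (1 + x) ^ 2 + 560 / ((7 + 3 * (1 + x) ^ 2) ^ 2 * ((1 + x) ^ 2 - 1))) * ψ₀ := by
  have h3 : (3 * x ^ 2 + 6 * x + 10 : ℝ) ≠ 0 := by nlinarith [sq_nonneg (x + 1)]
  have h7 : (7 + 3 * (1 + x) ^ 2 : ℝ) = 3 * x ^ 2 + 6 * x + 10 := by ring
  have hu : ((1 + x) ^ 2 - 1 : ℝ) = x * (x + 2) := by ring
  have hid : x * (-ψ₁ / (1 + x) + (9 / (1 + x) ^ 2 + 560 / ((7 + 3 * (1 + x) ^ 2) ^ 2 * ((1 + x) ^ 2 - 1))) * ψ₀)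
      + p x * ψ₁ + q x * ψ₀ = 0 := by
    rw [q_eq hx1 hx2, p, h7, hu]
    set t : ℝ := 3 * x ^ 2 + 6 * x + 10 with ht
    field_simp
    ring
  constructor
  · intro h
    have hsub : x * (D - (-ψ₁ / (1 + x)
        + (9 / (1 + x) ^ 2 + 560 / ((7 + 3 * (1 + x) ^ 2) ^ 2 * ((1 + x) ^ 2 - 1))) * ψ₀)) = 0 := by
      linear_combination h - hid
    rcases mul_eq_zero.1 hsub with h0 | h0
    · exact absurd h0 hx0
    · exact sub_eq_zero.1 h0
  · intro h
    rw [h]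
    exact hid

end M3

end TearingFRS1

end Summit.Ventures.FusionMHD.Models

end
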